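import Literature.Computability.AlgebraicComplexity.LaserMethodTypeCount
import Literature.Computability.AlgebraicComplexity.LaserMethodBigCW
import Literature.Computability.AlgebraicComplexity.MaxEntropyGivenMarginals
import HarnessLib

/-!
# SaturationLadder — twin rung, combinatorial layer: free diagonals of the five-letter types

Route `SaturationLadder` (sub-problem `MatrixMultiplication`), support for the aside
`TwinSaturation` (stmt-MatrixMultiplication-30539).  The twin Coppersmith–Winograd tensor `TW_b`
(`Theorems/SaturationLadderTwinCW.lean`) has the Coppersmith–Winograd support
`cwSupport₃ = {i + j + l = 2}` for its coarse levels (`Theorems/SaturationLadderTwinComponents.lean`),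
so the free-diagonal extraction of the first-power `CW_q` laser method applies to it VERBATIM; what
changes is the joint type.  The output-perfect twin laws of the instrument (cell `decomp-mm`, lens 1,
gen 8: `U, W, V′ = 2 − U, V = 0`) put mass on the five letters
`(1,1,0), (0,1,1), (1,0,1), (2,0,0), (0,0,2)` and NONE on `(0,2,0)` — whereas the `CW_q` family of
`Theorems/SaturationLadderExpSaturationDiagonal.lean` has no mass on `(0,2,0)` and `(0,0,2)`.

* Layer TB1 `twDiagonalRaw` (parametric in the five counts `n₁, n₂, n₃, n₅, n₆`,
  `N = n₁ + n₂ + n₃ + n₅ + n₆`): a free diagonal `Δ` of triples of level words of exactly this joint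
  type with `2^{N (min_m H(P_m) − Γ_S(P))} ≤ |Δ| · (N+1)^63 · 192 · exp(4 √(log 6 + N log 27))`
  (tree `exists_free_diagonal_jointType_card`, `S = cwSupport₃`, `b = 2`).
* Layer TB2: the marginals of the five-letter law `(a, w, w′, v, u)`
  (`X = (w + u, a + w′, v)`, `Y = (w′ + v + u, a + w, 0)`, `Z = (a + v, w + w′, u)`), and
  **`D(P) = {P}`** (`eq_of_mem_sameMarginalsOn_tw`): the vanishing level-`2` marginal in `Y` kills
  `(0,2,0)`, the level-`2` marginals in `X` and `Z` fix `(2,0,0)` and `(0,0,2)`, and the three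
  matrix letters are read off from the level-`0` marginals; hence `Γ_S(P) ≤ 0`
  (`maxEntropyPenalty_tw_nonpos`).
* `twDiagonal`: the two layers combined, penalty discharged — the input `Δ` of
  `Theorems/SaturationLadderTwinRestriction.lean` (`twChain`, `omegaRect_tw_le_of_card`), with the
  size bound `2^{N · min(H(X), H(Y), H(Z))} ≤ |Δ| · (N+1)^63 · 192 · exp(4 √(log 6 + N log 27))`.

References: Le Gall, ISSAC 2014, App. A.3 [LeGall2014]; Coppersmith–Winograd 1990 §6–7
[CoppersmithWinograd1990]; Bürgisser–Clausen–Shokrollahi 1997 §15.7–15.8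
[BurgisserClausenShokrollahi1997].  No new definitions, no named facts, no sorry.
-/

set_option linter.dupNamespace false
-- (single-conjunct summit: the namespace repeats `MatrixMultiplication`)

noncomputable section

open Finset
open scoped BigOperators

namespace Summit.MatrixMultiplication.MatrixMultiplication.Theorems.SaturationLadderTwinDiagonal

open Literature.Computability.AlgebraicComplexity

/-! ## Layer TB1 — a large free diagonal of the five-letter joint type -/

/-- **Combinatorial layer (parametric).** For counts `n₁, n₂, n₃, n₅, n₆` of the letters
`(1,1,0), (0,1,1), (1,0,1), (2,0,0), (0,0,2)` with `N = n₁ + n₂ + n₃ + n₅ + n₆ ≥ 1` and `P = Q/N`,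
there is a family `Δ` of triples of level words, coordinatewise in `cwSupport₃ = {i+j+l = 2}`, each
of exactly this joint type (no position of pattern `(0,2,0)`), forming a free diagonal, with
`2^{N (min_m H(P_m) − Γ_S(P))} ≤ |Δ| · (N+1)^63 · 192 · exp(4 √(log 6 + N log 27))`
(`exists_free_diagonal_jointType_card` for `S = cwSupport₃`, `b = 2`, `G = 27`, `A = 9`).
[cite: LeGall2014, Appendix A.3, Eq. (7) and p. 24] -/
theorem twDiagonalRaw :
    ∀ n₁ n₂ n₃ n₅ n₆ : ℕ, 0 < n₁ + n₂ + n₃ + n₅ + n₆ → ∀ P : Fin 3 × Fin 3 × Fin 3 → ℝ,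
      (∀ s, P s = ((if s = (1, 1, 0) then n₁ else if s = (0, 1, 1) then n₂
          else if s = (1, 0, 1) then n₃ else if s = (2, 0, 0) then n₅
          else if s = (0, 0, 2) then n₆ else 0 : ℕ) : ℝ) /
            (((n₁ + n₂ + n₃ + n₅ + n₆ : ℕ)) : ℝ)) →
      ∃ Δ : Finset ((Fin (n₁ + n₂ + n₃ + n₅ + n₆) → Fin 3) × (Fin (n₁ + n₂ + n₃ + n₅ + n₆) → Fin 3) ×
          (Fin (n₁ + n₂ + n₃ + n₅ + n₆) → Fin 3)),
        (∀ δ ∈ Δ, ∀ ρ, labelSeq δ ρ ∈ cwSupport₃) ∧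
        (∀ δ ∈ Δ, letterCount (labelSeq δ) (1, 1, 0) = n₁ ∧
          letterCount (labelSeq δ) (0, 1, 1) = n₂ ∧ letterCount (labelSeq δ) (1, 0, 1) = n₃ ∧
          letterCount (labelSeq δ) (0, 2, 0) = 0 ∧ letterCount (labelSeq δ) (2, 0, 0) = n₅) ∧
        (∀ δ ∈ Δ, ∀ δ' ∈ Δ, ∀ δ'' ∈ Δ, (∀ ρ, (δ.1 ρ, δ'.2.1 ρ, δ''.2.2 ρ) ∈ cwSupport₃) →
          δ = δ' ∧ δ' = δ'') ∧
        (2 : ℝ) ^ ((((n₁ + n₂ + n₃ + n₅ + n₆ : ℕ)) : ℝ) *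
            (min (shannonEntropy (marginalDist₁ P))
              (min (shannonEntropy (marginalDist₂ P)) (shannonEntropy (marginalDist₃ P))) -
              maxEntropyPenalty cwSupport₃ P)) ≤
          (Δ.card : ℝ) * (((((n₁ + n₂ + n₃ + n₅ + n₆ : ℕ)) : ℝ)) + 1) ^ 63 * 192 *
            Real.exp (4 * Real.sqrt (Real.log 6 +
              (((n₁ + n₂ + n₃ + n₅ + n₆ : ℕ)) : ℝ) * Real.log 27)) := by
  intro n₁ n₂ n₃ n₅ n₆ hN P hP
  classical
  -- tightness data of `cwSupport₃` (as in `bigCw_laser_inequality`)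
  have hinj : Function.Injective fun (i : Fin 3) (_ : Fin 1) => (i : ℤ) := by
    intro i i' h
    have h0 := congrFun h 0
    simp only [Nat.cast_inj] at h0
    exact Fin.ext h0
  have hinjγ : Function.Injective fun (l : Fin 3) (_ : Fin 1) => (l : ℤ) - 2 := by
    intro l l' h
    have h0 := congrFun h 0
    simp only [sub_left_inj, Nat.cast_inj] at h0
    exact Fin.ext h0
  have hbd : ∀ (i : Fin 3) (ρ : Fin 1), |((fun (i : Fin 3) (_ : Fin 1) => (i : ℤ)) i ρ)| ≤ (2 : ℕ) := by
    intro i ρ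
    have := i.isLt
    simp only [Nat.cast_ofNat, Nat.abs_cast]
    omega
  have htight : ∀ s ∈ cwSupport₃, ∀ ρ : Fin 1,
      (fun (i : Fin 3) (_ : Fin 1) => (i : ℤ)) s.1 ρ + (fun (j : Fin 3) (_ : Fin 1) => (j : ℤ)) s.2.1 ρ +
        (fun (l : Fin 3) (_ : Fin 1) => (l : ℤ) - 2) s.2.2 ρ = 0 := by
    intro s hs ρ
    rw [mem_cwSupport₃] at hs
    simp only
    omega
  -- the joint type `Q` and `N`
  obtain ⟨Q, hQdef⟩ : ∃ Q : Fin 3 × Fin 3 × Fin 3 → ℕ, Q = fun s =>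
      if s = (1, 1, 0) then n₁ else if s = (0, 1, 1) then n₂
      else if s = (1, 0, 1) then n₃ else if s = (2, 0, 0) then n₅
      else if s = (0, 0, 2) then n₆ else 0 :=
    ⟨_, rfl⟩
  have hQS : ∀ s, s ∉ cwSupport₃ → Q s = 0 := by
    intro s hs
    rw [mem_cwSupport₃_iff] at hs
    push Not at hs
    obtain ⟨h1, h2, h3, h4, -, h6⟩ := hs
    simp [hQdef, h1, h2, h3, h4, h6]
  have hQ : ∑ s, Q s = n₁ + n₂ + n₃ + n₅ + n₆ := by
    rw [sum_triple_eq, hQdef]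
    simp [Fin.sum_univ_three]
    ring
  have hP' : ∀ s, P s = (Q s : ℝ) / (((n₁ + n₂ + n₃ + n₅ + n₆ : ℕ)) : ℝ) := by
    intro s
    rw [hQdef]
    exact hP s
  -- the tree theorem
  obtain ⟨Δ, hΔQ, hfree, hsize⟩ := exists_free_diagonal_jointType_card cwSupport₃ (r := 1) (b := 2)
    (fun (i : Fin 3) (_ : Fin 1) => (i : ℤ)) (fun (j : Fin 3) (_ : Fin 1) => (j : ℤ))
    (fun (l : Fin 3) (_ : Fin 1) => (l : ℤ) - 2) hinj hinj hinjγ hbd hbd htight hN Q hQS hQ P hP'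
  have hQδ : ∀ δ ∈ Δ, letterCount (labelSeq δ) = Q := fun δ hδ => (Finset.mem_filter.1 (hΔQ hδ)).2
  refine ⟨Δ, ?_, ?_, hfree, ?_⟩
  · -- coordinatewise support
    intro δ hδ ρ
    by_contra hρ
    have h0 := hQS _ hρ
    rw [← hQδ δ hδ] at h0
    exact (letterCount_pos_of_apply (labelSeq δ) ρ).ne' h0
  · -- the five letter counts
    intro δ hδ
    rw [hQδ δ hδ, hQdef]
    simp
  · -- the size bound, constants evaluated
    refine hsize.trans_eq ?_
    have hmax : (max 2 1 : ℕ) = 2 := by decide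
    generalize (((n₁ + n₂ + n₃ + n₅ + n₆ : ℕ)) : ℝ) = Nr
    simp only [Fintype.card_prod, Fintype.card_fin, hmax]
    norm_num
    simp only [mul_assoc]

/-! ## Layer TB2 — the five-letter law: marginals and `Γ_S(P) = 0` -/

/-- The three marginals of the law `a` on `(1,1,0)`, `w` on `(0,1,1)`, `w′` on `(1,0,1)`, `v` on
`(2,0,0)`, `u` on `(0,0,2)`: `X = (w + u, a + w′, v)`, `Y = (w′ + v + u, a + w, 0)`,
`Z = (a + v, w + w′, u)`. [folklore] -/
theorem marginalDist_tw {P : Fin 3 × Fin 3 × Fin 3 → ℝ} {a w w' v u : ℝ}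
    (hP : ∀ s, P s = if s = (1, 1, 0) then a else if s = (0, 1, 1) then w
      else if s = (1, 0, 1) then w' else if s = (2, 0, 0) then v else if s = (0, 0, 2) then u else 0) :
    marginalDist₁ P = ![w + u, a + w', v] ∧ marginalDist₂ P = ![w' + v + u, a + w, 0] ∧
      marginalDist₃ P = ![a + v, w + w', u] := by
  refine ⟨?_, ?_, ?_⟩ <;> funext i <;> fin_cases i <;>
    simp [marginalDist₁, marginalDist₂, marginalDist₃, Fin.sum_univ_three, hP] <;> ring

/-- The law vanishes off the support `{i + j + l = 2}`. [folklore] -/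
theorem tw_eq_zero_of_not_mem {P : Fin 3 × Fin 3 × Fin 3 → ℝ} {a w w' v u : ℝ}
    (hP : ∀ s, P s = if s = (1, 1, 0) then a else if s = (0, 1, 1) then w
      else if s = (1, 0, 1) then w' else if s = (2, 0, 0) then v else if s = (0, 0, 2) then u else 0)
    {s : Fin 3 × Fin 3 × Fin 3} (hs : s ∉ cwSupport₃) : P s = 0 := by
  rw [mem_cwSupport₃_iff] at hs
  push Not at hs
  rw [hP]
  simp [hs.1, hs.2.1, hs.2.2.1, hs.2.2.2.1, hs.2.2.2.2.2]

/-- **`D(P) = {P}`** for the five-letter law: a distribution supported in `{i + j + l = 2}` with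
the same marginals coincides with it — the level-`2` marginal in `Y` vanishes, killing `(0,2,0)`;
the level-`2` marginals in `X` and `Z` fix `(2,0,0)` and `(0,0,2)`; then each matrix pattern is read
off from one level-`0` marginal. [folklore] -/
theorem eq_of_mem_sameMarginalsOn_tw {P P' : Fin 3 × Fin 3 × Fin 3 → ℝ} {a w w' v u : ℝ}
    (hP : ∀ s, P s = if s = (1, 1, 0) then a else if s = (0, 1, 1) then w
      else if s = (1, 0, 1) then w' else if s = (2, 0, 0) then v else if s = (0, 0, 2) then u else 0)
    (hP' : P' ∈ sameMarginalsOn cwSupport₃ P) : P' = P := by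
  obtain ⟨-, hoff, h₁, h₂, h₃⟩ := hP'
  obtain ⟨hm₁, hm₂, hm₃⟩ := marginalDist_tw hP
  -- the off-support zeros of `P'`
  have z : ∀ a b c : Fin 3, (a : ℕ) + b + c ≠ 2 → P' (a, b, c) = 0 := fun a b c h =>
    hoff _ (mt mem_cwSupport₃.1 h)
  -- the six marginal equations we use
  have e₁ : marginalDist₁ P' 2 = v := by rw [h₁, hm₁]; simp
  have e₂ : marginalDist₂ P' 2 = 0 := by rw [h₂, hm₂]; simp
  have e₃ : marginalDist₃ P' 2 = u := by rw [h₃, hm₃]; simp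
  have f₁ : marginalDist₁ P' 0 = w + u := by rw [h₁, hm₁]; simp
  have f₂ : marginalDist₂ P' 0 = w' + v + u := by rw [h₂, hm₂]; simp
  have f₃ : marginalDist₃ P' 0 = a + v := by rw [h₃, hm₃]; simp
  simp (disch := decide) only [marginalDist₁, marginalDist₂, marginalDist₃, Fin.sum_univ_three, z,
    add_zero, zero_add] at e₁ e₂ e₃ f₁ f₂ f₃
  have p011 : P' (0, 1, 1) = w := by linarith
  have p101 : P' (1, 0, 1) = w' := by linarith
  have p110 : P' (1, 1, 0) = a := by linarith
  funext s
  by_cases hs : s ∈ cwSupport₃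
  · rw [hP]
    rw [mem_cwSupport₃_iff] at hs
    rcases hs with rfl | rfl | rfl | rfl | rfl | rfl <;> simp [p011, p101, p110, e₁, e₂, e₃]
  · rw [hoff s hs, tw_eq_zero_of_not_mem hP hs]

/-- **The penalty vanishes**: `Γ_S(P) = max_{D(P)} H − H(P) ≤ 0` for the five-letter law, provided
it IS a probability distribution. [folklore] -/
theorem maxEntropyPenalty_tw_nonpos {P : Fin 3 × Fin 3 × Fin 3 → ℝ} {a w w' v u : ℝ}
    (hP : ∀ s, P s = if s = (1, 1, 0) then a else if s = (0, 1, 1) then w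
      else if s = (1, 0, 1) then w' else if s = (2, 0, 0) then v else if s = (0, 0, 2) then u else 0)
    (ha : 0 ≤ a) (hw : 0 ≤ w) (hw' : 0 ≤ w') (hv : 0 ≤ v) (hu : 0 ≤ u)
    (hsum : a + w + w' + v + u = 1) :
    maxEntropyPenalty cwSupport₃ P ≤ 0 := by
  have hsimplex : P ∈ stdSimplex ℝ (Fin 3 × Fin 3 × Fin 3) := by
    refine ⟨fun s => ?_, ?_⟩
    · rw [hP]
      split_ifs <;> linarith
    · rw [sum_triple_eq]
      simp [Fin.sum_univ_three, hP]
      linarith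
  have hsupp : ∀ x, x ∉ cwSupport₃ → P x = 0 := fun x hx => tw_eq_zero_of_not_mem hP hx
  have hle : maxEntropyGivenMarginals cwSupport₃ P ≤ shannonEntropy P :=
    maxEntropyGivenMarginals_le ⟨P, self_mem_sameMarginalsOn hsimplex hsupp⟩
      fun P' hP' => (congrArg shannonEntropy (eq_of_mem_sameMarginalsOn_tw hP hP')).le
  exact sub_nonpos.2 hle

/-! ## The two layers combined -/

/-- **Free diagonals of the twin types.**  For counts `n₁, n₂, n₃, n₅, n₆` (letters
`(1,1,0), (0,1,1), (1,0,1), (2,0,0), (0,0,2)`; none of `(0,2,0)`), `N = n₁ + ⋯ + n₆ ≥ 1`, there is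
a free diagonal `Δ` of `cwSupport₃^N`-supported triples of exactly this joint type with
`2^{N · min(H(X), H(Y), H(Z))} ≤ |Δ| · (N+1)^63 · 192 · exp(4 √(log 6 + N log 27))`, where
`X = (n₂+n₆, n₁+n₃, n₅)/N`, `Y = (n₃+n₅+n₆, n₁+n₂, 0)/N`, `Z = (n₁+n₅, n₂+n₃, n₆)/N`.
[cite: LeGall2014, Appendix A.3] -/
theorem twDiagonal (n₁ n₂ n₃ n₅ n₆ : ℕ) (hN : 0 < n₁ + n₂ + n₃ + n₅ + n₆) :
    ∃ Δ : Finset ((Fin (n₁ + n₂ + n₃ + n₅ + n₆) → Fin 3) × (Fin (n₁ + n₂ + n₃ + n₅ + n₆) → Fin 3) ×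
        (Fin (n₁ + n₂ + n₃ + n₅ + n₆) → Fin 3)),
      (∀ δ ∈ Δ, ∀ ρ, labelSeq δ ρ ∈ cwSupport₃) ∧
      (∀ δ ∈ Δ, letterCount (labelSeq δ) (1, 1, 0) = n₁ ∧
        letterCount (labelSeq δ) (0, 1, 1) = n₂ ∧ letterCount (labelSeq δ) (1, 0, 1) = n₃ ∧
        letterCount (labelSeq δ) (0, 2, 0) = 0 ∧ letterCount (labelSeq δ) (2, 0, 0) = n₅) ∧
      (∀ δ ∈ Δ, ∀ δ' ∈ Δ, ∀ δ'' ∈ Δ, (∀ ρ, (δ.1 ρ, δ'.2.1 ρ, δ''.2.2 ρ) ∈ cwSupport₃) →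
        δ = δ' ∧ δ' = δ'') ∧
      (2 : ℝ) ^ ((((n₁ + n₂ + n₃ + n₅ + n₆ : ℕ)) : ℝ) *
          min (shannonEntropy ![((n₂ : ℝ) + n₆) / (n₁ + n₂ + n₃ + n₅ + n₆ : ℕ),
              ((n₁ : ℝ) + n₃) / (n₁ + n₂ + n₃ + n₅ + n₆ : ℕ), (n₅ : ℝ) / (n₁ + n₂ + n₃ + n₅ + n₆ : ℕ)])
            (min (shannonEntropy ![((n₃ : ℝ) + n₅ + n₆) / (n₁ + n₂ + n₃ + n₅ + n₆ : ℕ),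
              ((n₁ : ℝ) + n₂) / (n₁ + n₂ + n₃ + n₅ + n₆ : ℕ), 0])
              (shannonEntropy ![((n₁ : ℝ) + n₅) / (n₁ + n₂ + n₃ + n₅ + n₆ : ℕ),
                ((n₂ : ℝ) + n₃) / (n₁ + n₂ + n₃ + n₅ + n₆ : ℕ),
                (n₆ : ℝ) / (n₁ + n₂ + n₃ + n₅ + n₆ : ℕ)]))) ≤
        (Δ.card : ℝ) * (((((n₁ + n₂ + n₃ + n₅ + n₆ : ℕ)) : ℝ)) + 1) ^ 63 * 192 *
          Real.exp (4 * Real.sqrt (Real.log 6 +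
            (((n₁ + n₂ + n₃ + n₅ + n₆ : ℕ)) : ℝ) * Real.log 27)) := by
  classical
  set Nr : ℝ := (((n₁ + n₂ + n₃ + n₅ + n₆ : ℕ)) : ℝ) with hNr
  have hNr0 : 0 < Nr := by rw [hNr]; exact_mod_cast hN
  -- the law `P = Q / N`
  obtain ⟨P, hPdef⟩ : ∃ P : Fin 3 × Fin 3 × Fin 3 → ℝ, P = fun s =>
      ((if s = (1, 1, 0) then n₁ else if s = (0, 1, 1) then n₂
          else if s = (1, 0, 1) then n₃ else if s = (2, 0, 0) then n₅
          else if s = (0, 0, 2) then n₆ else 0 : ℕ) : ℝ) / Nr := ⟨_, rfl⟩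
  have hP : ∀ s, P s = ((if s = (1, 1, 0) then n₁ else if s = (0, 1, 1) then n₂
      else if s = (1, 0, 1) then n₃ else if s = (2, 0, 0) then n₅
      else if s = (0, 0, 2) then n₆ else 0 : ℕ) : ℝ) / Nr := fun s => by rw [hPdef]
  obtain ⟨Δ, hS, hcnt, hfree, hsize⟩ := twDiagonalRaw n₁ n₂ n₃ n₅ n₆ hN P hP
  refine ⟨Δ, hS, hcnt, hfree, ?_⟩
  -- the law in the five-letter form
  have hP5 : ∀ s, P s = if s = (1, 1, 0) then (n₁ : ℝ) / Nr else if s = (0, 1, 1) then (n₂ : ℝ) / Nr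
      else if s = (1, 0, 1) then (n₃ : ℝ) / Nr else if s = (2, 0, 0) then (n₅ : ℝ) / Nr
      else if s = (0, 0, 2) then (n₆ : ℝ) / Nr else 0 := by
    intro s
    rw [hP]
    split_ifs <;> push_cast <;> ring
  obtain ⟨hm₁, hm₂, hm₃⟩ := marginalDist_tw hP5
  have hsum : (n₁ : ℝ) / Nr + (n₂ : ℝ) / Nr + (n₃ : ℝ) / Nr + (n₅ : ℝ) / Nr + (n₆ : ℝ) / Nr = 1 := by
    rw [← add_div, ← add_div, ← add_div, ← add_div, div_eq_one_iff_eq hNr0.ne', hNr]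
    push_cast; ring
  have hpen : maxEntropyPenalty cwSupport₃ P ≤ 0 :=
    maxEntropyPenalty_tw_nonpos hP5 (by positivity) (by positivity) (by positivity) (by positivity)
      (by positivity) hsum
  -- compare the exponents
  refine le_trans ?_ hsize
  rw [hm₁, hm₂, hm₃]
  have e1 : ![((n₂ : ℝ) + n₆) / Nr, ((n₁ : ℝ) + n₃) / Nr, (n₅ : ℝ) / Nr] =
      ![(n₂ : ℝ) / Nr + (n₆ : ℝ) / Nr, (n₁ : ℝ) / Nr + (n₃ : ℝ) / Nr, (n₅ : ℝ) / Nr] := by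
    simp only [add_div]
  have e2 : ![((n₃ : ℝ) + n₅ + n₆) / Nr, ((n₁ : ℝ) + n₂) / Nr, 0] =
      ![(n₃ : ℝ) / Nr + (n₅ : ℝ) / Nr + (n₆ : ℝ) / Nr, (n₁ : ℝ) / Nr + (n₂ : ℝ) / Nr, 0] := by
    simp only [add_div]
  have e3 : ![((n₁ : ℝ) + n₅) / Nr, ((n₂ : ℝ) + n₃) / Nr, (n₆ : ℝ) / Nr] =
      ![(n₁ : ℝ) / Nr + (n₅ : ℝ) / Nr, (n₂ : ℝ) / Nr + (n₃ : ℝ) / Nr, (n₆ : ℝ) / Nr] := by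
    simp only [add_div]
  rw [e1, e2, e3]
  refine Real.rpow_le_rpow_of_exponent_le (by norm_num) ?_
  nlinarith [hpen, hNr0]

end Summit.MatrixMultiplication.MatrixMultiplication.Theorems.SaturationLadderTwinDiagonal

end
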